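import Literature.AnabelianGeometry.AbsoluteAnabelian.NeukirchUchidaSeparationMovers
import Literature.AnabelianGeometry.AbsoluteAnabelian.NeukirchUchidaDegreeTransfer
import Literature.NumberTheory.GaloisRepresentations.NeukirchNFBinders
import HarnessLib

/-!
# The Neukirch–Uchida deduction, row R10b (part 3): the separation oracle

Cell abc-iut, layer L4, row «G-L4d2g4-1-NU-DEDUCTION» (sub-DAG `plan/L4/SUBDAG-NeukirchUchida.md`,
row R10b).  This file DISCHARGES the third conjunct `hsep` of the `hrows` binder of
`NeukirchUchidaProof.neukirchUchida_of_rows` (`NeukirchUchidaRatCore`), i.e. the separation oracle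
of `NeukirchUchidaProof.existsUnique_forall_eq_conj_of_rows` /
`NeukirchUchidaProof.existsUnique_forall_eq_conj_of_containment_of_sep` (abc-iut-w6-d108), from the
(12.1.9)-containments for `β : V₁ ⥲ V₂` and `β⁻¹` alone.

Contents (`Γ = absoluteGaloisGroup ℚ`, `Γ_K = ΓK K`, `D_A = MulAction.stabilizer Γ A`):

* `under_absIntegersCentre_eq` — «`A` lies over the place `v₀` of `ℚ`» read on the centre
  `𝔪_A ∩ ℤ̄`; `exists_smul_eq_of_over` — two nonarchimedean primes of `ℚ̄` over the same place of
  `ℚ` are `Γ`-conjugate (abc-iut-w6-d070's `exists_smul_eq_of_under_absIntegersCentre_eq`).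
* `over_of_map_stabilizer_eq` — the prime correspondence `β(D_A ∩ V₁) = D_B ∩ V₂` preserves the
  place of `ℚ` below (row R2, `invariants_of_stabilizer_inf_ΓK_equiv`, abc-iut-w5-d116, along
  row R4 (b)'s `exists_continuousMulEquiv_stabilizer_inf`; the argument of abc-iut-w6-d108's
  `hdeg_hP₁_of_containment`, binder (R2)).
* the invariance `β(Γ_L ∩ V₁) = Γ_L ∩ V₂`, `Γ_L ≤ V₂` of every finite Galois level `Γ_L ≤ V₁` is
  abc-iut-w6-d108's `map_ΓK_subgroupOf_eq_of_containment` (rows R4 + R6), consumed by name.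
* **`separation_oracle`** — for finite Galois `N ≤ M` with `Γ_N ≤ V₁`: a prime `A₀`, elements
  `m₀, m₁ ∈ Γ` with `β(D_{A₀} ∩ V₁) = D_{m₀ A₀} ∩ V₂`, such that every `m` matching `β` on
  `D_{a A₀} ∩ Γ_N` (`a ∈ Γ_N`) satisfies `m⁻¹ m₁ ∈ Γ_M` — by `pair_separation` at two distinct odd
  rational primes splitting completely in `M` (infinitely many: `hasStrongDirichletDensity_splitPrimes`).

Proofs only; no new definitions.  References: [NSW2008, (12.1.9), (12.2.1)], [Neukirch1999, I §8–§9].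
-/

noncomputable section

open scoped Pointwise NumberField
open Field NumberField IsDedekindDomain
open Literature.NumberTheory.GaloisRepresentations
open Literature.NumberTheory.GaloisRepresentations.NeukirchUchidaProof

namespace Literature.AnabelianGeometry.AbsoluteAnabelian

namespace NeukirchUchidaProof

variable {V₁ V₂ : Subgroup (absoluteGaloisGroup ℚ)}

/-! ### Places of `ℚ` below nonarchimedean primes of `ℚ̄` -/

/-- If `A` lies over the place `v₀` of `ℚ` (`r ∈ 𝔪_A ↔ r ∈ 𝔭_{v₀}` for `r ∈ 𝓞 ℚ`), then the centre
`𝔪_A ∩ ℤ̄` of `A` contracts to `𝔭_{v₀}` in `𝓞 ℚ`. [cite: NeukirchANT1999, Ch. I §9 Prop. (9.1)] -/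
theorem under_absIntegersCentre_eq {A : ValuationSubring (AlgebraicClosure ℚ)}
    {v₀ : HeightOneSpectrum (𝓞 ℚ)}
    (hvA : ∀ r : 𝓞 ℚ, algebraMap ℚ (AlgebraicClosure ℚ) r ∈ A.nonunits ↔ r ∈ v₀.asIdeal) :
    (absIntegersCentre A).under (𝓞 ℚ) = v₀.asIdeal := by
  ext r
  rw [Ideal.under_def, Ideal.mem_comap, mem_absIntegersCentre_iff, ← hvA r, Subalgebra.coe_algebraMap]
  exact Iff.rfl

/-- **Transitivity over `ℚ`.**  Two nonarchimedean primes of `ℚ̄` over the same place of `ℚ` are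
conjugate under `Γ = G_ℚ`. [cite: NeukirchANT1999, Ch. I §9 Prop. (9.1)] -/
theorem exists_smul_eq_of_over {A B : ValuationSubring (AlgebraicClosure ℚ)} (hB : B ≠ ⊤)
    {v₀ : HeightOneSpectrum (𝓞 ℚ)}
    (hvA : ∀ r : 𝓞 ℚ, algebraMap ℚ (AlgebraicClosure ℚ) r ∈ A.nonunits ↔ r ∈ v₀.asIdeal)
    (hvB : ∀ r : 𝓞 ℚ, algebraMap ℚ (AlgebraicClosure ℚ) r ∈ B.nonunits ↔ r ∈ v₀.asIdeal) :
    ∃ m : absoluteGaloisGroup ℚ, m • A = B :=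
  ExplicitMuCocycles.exists_smul_eq_of_under_absIntegersCentre_eq ℚ hB
    ((under_absIntegersCentre_eq hvA).trans (under_absIntegersCentre_eq hvB).symm)

/-- **The prime correspondence preserves the place of `ℚ` below** (row R2 along row R4 (b), the
binder (R2) of abc-iut-w6-d108's counting): if `β(D_A ∩ V₁) = D_B ∩ V₂` for open `V₁, V₂ ≤ Γ` and
`A` lies over `v₀`, so does `B`.  The residue characteristic is read off the topological group
`D_A ∩ V₁ ≃ₜ* D_B ∩ V₂` (`invariants_of_stabilizer_inf_ΓK_equiv`).
[cite: NeukirchSchmidtWingberg2008, Thm (12.2.1)] -/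
theorem over_of_map_stabilizer_eq (hV₁ : IsOpen (V₁ : Set (absoluteGaloisGroup ℚ)))
    (hV₂ : IsOpen (V₂ : Set (absoluteGaloisGroup ℚ))) (β : V₁ ≃ₜ* V₂)
    {A B : ValuationSubring (AlgebraicClosure ℚ)} (hA : A ≠ ⊤) (hB : B ≠ ⊤)
    (hAB : ((MulAction.stabilizer (absoluteGaloisGroup ℚ) A).subgroupOf V₁).map
        β.toMulEquiv.toMonoidHom = (MulAction.stabilizer (absoluteGaloisGroup ℚ) B).subgroupOf V₂)
    (v₀ : HeightOneSpectrum (𝓞 ℚ))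
    (hvA : ∀ r : 𝓞 ℚ, algebraMap ℚ (AlgebraicClosure ℚ) r ∈ A.nonunits ↔ r ∈ v₀.asIdeal) :
    ∀ r : 𝓞 ℚ, algebraMap ℚ (AlgebraicClosure ℚ) r ∈ B.nonunits ↔ r ∈ v₀.asIdeal := by
  classical
  set W : Subgroup (absoluteGaloisGroup ℚ) :=
    ((V₁.subgroupOf V₁).map β.toMulEquiv.toMonoidHom).map V₂.subtype with hWdef
  have hW : IsOpen (W : Set (absoluteGaloisGroup ℚ)) :=
    isOpen_map_map_subtype_of_continuousMulEquiv hV₂ β V₁ hV₁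
  haveI : FiniteDimensional ℚ (KV V₁) := finiteDimensional_KV V₁ hV₁
  haveI : FiniteDimensional ℚ (KV W) := finiteDimensional_KV W hW
  haveI : NumberField (KV V₁) := numberField_intermediateField (KV V₁)
  haveI : NumberField (KV W) := numberField_intermediateField (KV W)
  have hΓV : ΓK (KV V₁) = V₁ := ΓK_KV V₁ hV₁
  have hΓW : ΓK (KV W) = W := ΓK_KV W hW
  obtain ⟨P, hPA, -⟩ := existsUnique_ideal_below (KV V₁) A
  obtain ⟨P', hP'B, -⟩ := existsUnique_ideal_below (KV W) B
  haveI hPmax : P.IsMaximal := isMaximal_of_below (KV V₁) A hA hPA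
  haveI hP'max : P'.IsMaximal := isMaximal_of_below (KV W) B hB hP'B
  let vK : HeightOneSpectrum (𝓞 (KV V₁)) := ⟨P, hPmax.isPrime, ne_bot_of_below (KV V₁) A hA hPA⟩
  let vK' : HeightOneSpectrum (𝓞 (KV W)) := ⟨P', hP'max.isPrime, ne_bot_of_below (KV W) B hB hP'B⟩
  have hequiv : Nonempty (↥(MulAction.stabilizer (absoluteGaloisGroup ℚ) A ⊓ ΓK (KV V₁)) ≃ₜ*
      ↥(MulAction.stabilizer (absoluteGaloisGroup ℚ) B ⊓ ΓK (KV W))) := by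
    rw [hΓV, hΓW]
    obtain ⟨e, -⟩ := exists_continuousMulEquiv_stabilizer_inf β (le_refl V₁) hAB
    exact ⟨e⟩
  obtain ⟨e⟩ := hequiv
  obtain ⟨hchar, -⟩ :=
    invariants_of_stabilizer_inf_ΓK_equiv (KV V₁) (KV W) A hA vK hPA B hB vK' hP'B e
  have hunder := under_eq_under_of_forall_natCast_mem_iff (ne_bot_of_below (KV V₁) A hA hPA) hchar
  rw [over_iff_under_eq (KV W) hP'B v₀]
  rw [over_iff_under_eq (KV V₁) hPA v₀] at hvA
  exact hunder.symm.trans hvA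

/-! ### The separation oracle -/

/-- Two distinct ODD rational primes splitting completely in the finite Galois extension `M/ℚ`
(the completely split primes have density `1/[M:ℚ]`, `hasStrongDirichletDensity_splitPrimes`, hence
are infinitely many; only finitely many places divide `2`). [cite: NeukirchANT1999, Ch. VII §13 (13.4)] -/
theorem exists_two_odd_splitPrimes (M : IntermediateField ℚ (AlgebraicClosure ℚ))
    [FiniteDimensional ℚ M] [IsGalois ℚ M] :
    ∃ v₀ v₁ : HeightOneSpectrum (𝓞 ℚ), v₀ ≠ v₁ ∧ (2 : 𝓞 ℚ) ∉ v₀.asIdeal ∧ (2 : 𝓞 ℚ) ∉ v₁.asIdeal ∧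
      v₀ ∈ splitPrimes ℚ M ∧ v₁ ∈ splitPrimes ℚ M := by
  classical
  haveI : NumberField M := numberField_intermediateField M
  have hinf : (splitPrimes ℚ M).Infinite :=
    (hasStrongDirichletDensity_splitPrimes ℚ M).infinite
      (one_div_pos.mpr (Nat.cast_pos.mpr Module.finrank_pos))
  have hfin : {v : HeightOneSpectrum (𝓞 ℚ) | (2 : 𝓞 ℚ) ∈ v.asIdeal}.Finite := by
    have h2 : (Ideal.span {(2 : 𝓞 ℚ)} : Ideal (𝓞 ℚ)) ≠ ⊥ := by
      rw [Ne, Ideal.span_singleton_eq_bot]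
      exact two_ne_zero
    refine (Ideal.finite_factors h2).subset ?_
    intro v hv
    exact Ideal.dvd_span_singleton.mpr hv
  have hS : (splitPrimes ℚ M \ {v | (2 : 𝓞 ℚ) ∈ v.asIdeal}).Infinite := hinf.sdiff hfin
  obtain ⟨v₀, hv₀⟩ := hS.nonempty
  obtain ⟨v₁, hv₁⟩ := (hS.sdiff (Set.finite_singleton v₀)).nonempty
  refine ⟨v₀, v₁, ?_, hv₀.2, hv₁.1.2, hv₀.1, hv₁.1.1⟩
  intro h
  exact hv₁.2 (by rw [h]; exact Set.mem_singleton v₁)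

/-- A nonarchimedean prime of `ℚ̄` over a given place `v₀` of `ℚ`, through a prime of the finite
`M/ℚ` (`Ideal.exists_maximal_ideal_liesOver_of_isIntegral`, `exists_valuationSubring_below`).
[cite: NeukirchANT1999, Ch. II §8 Thm. (8.1)] -/
theorem exists_over (M : IntermediateField ℚ (AlgebraicClosure ℚ)) [FiniteDimensional ℚ M]
    (v₀ : HeightOneSpectrum (𝓞 ℚ)) :
    ∃ A : ValuationSubring (AlgebraicClosure ℚ), A ≠ ⊤ ∧
      ∀ r : 𝓞 ℚ, algebraMap ℚ (AlgebraicClosure ℚ) r ∈ A.nonunits ↔ r ∈ v₀.asIdeal := by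
  haveI : NumberField M := numberField_intermediateField M
  haveI := v₀.isMaximal
  obtain ⟨Q, hQmax, hQ⟩ := Ideal.exists_maximal_ideal_liesOver_of_isIntegral (S := 𝓞 M) v₀.asIdeal
  haveI := hQmax
  obtain ⟨A, hA, hQA⟩ := exists_valuationSubring_below M Q
  refine ⟨A, hA, (over_iff_under_eq M hQA v₀).mpr hQ.over.symm⟩

/-- **The separation oracle** (row R10b; = the `hsep` binder of `existsUnique_forall_eq_conj_of_rows`
/ `existsUnique_forall_eq_conj_of_containment_of_sep`, and the third conjunct of `hrows` in
`neukirchUchida_of_rows`).  `V₁, V₂ ≤ Γ` open, `β : V₁ ⥲ V₂` with the (12.1.9)-containments for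
`β`, `β⁻¹`; `N ≤ M` finite Galois over `ℚ` inside `ℚ̄` with `Γ_N ≤ V₁`.  Then there are a
nonarchimedean prime `A₀` and `m₀, m₁ ∈ Γ` with `β(D_{A₀} ∩ V₁) = D_{m₀ A₀} ∩ V₂` such that for all
`a ∈ Γ_N` and all `m ∈ Γ` with «`g ∈ D_{a A₀} ↔ β g ∈ D_{m a A₀}` on `Γ_N`» one has `m⁻¹ m₁ ∈ Γ_M`.
CONSTRUCTION: `A₀`, `A₁` over two distinct odd rational primes `v₀ ≠ v₁` splitting completely in
`M`; `m₀ A₀`, `m₁ A₁` their `β`-correspondents (row R1, same place below by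
`over_of_map_stabilizer_eq`, transitivity `exists_smul_eq_of_over`); then `pair_separation` at
`(a A₀, A₁)` with `β` restricted to `Γ_M` (`exists_mulEquiv_restrict`,
`map_ΓK_subgroupOf_eq_of_containment`). [cite: NeukirchSchmidtWingberg2008, Thm (12.2.1)] -/
theorem separation_oracle (hV₁ : IsOpen (V₁ : Set (absoluteGaloisGroup ℚ)))
    (hV₂ : IsOpen (V₂ : Set (absoluteGaloisGroup ℚ))) (β : V₁ ≃ₜ* V₂)
    (hβ : ∀ A : ValuationSubring (AlgebraicClosure ℚ), A ≠ ⊤ →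
      ∃ B : ValuationSubring (AlgebraicClosure ℚ), B ≠ ⊤ ∧
        ((MulAction.stabilizer (absoluteGaloisGroup ℚ) A).subgroupOf V₁).map β.toMulEquiv.toMonoidHom ≤
          (MulAction.stabilizer (absoluteGaloisGroup ℚ) B).subgroupOf V₂)
    (hβ' : ∀ B : ValuationSubring (AlgebraicClosure ℚ), B ≠ ⊤ →
      ∃ A : ValuationSubring (AlgebraicClosure ℚ), A ≠ ⊤ ∧
        ((MulAction.stabilizer (absoluteGaloisGroup ℚ) B).subgroupOf V₂).map
            β.toMulEquiv.symm.toMonoidHom ≤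
          (MulAction.stabilizer (absoluteGaloisGroup ℚ) A).subgroupOf V₁)
    (N : IntermediateField ℚ (AlgebraicClosure ℚ)) (hNV : ΓK N ≤ V₁)
    (M : IntermediateField ℚ (AlgebraicClosure ℚ)) (hMfin : FiniteDimensional ℚ M)
    (hMgal : IsGalois ℚ M) (hNM : N ≤ M) :
    ∃ (A₀ : ValuationSubring (AlgebraicClosure ℚ)) (m₀ m₁ : absoluteGaloisGroup ℚ),
      ((MulAction.stabilizer (absoluteGaloisGroup ℚ) A₀).subgroupOf V₁).map β.toMulEquiv.toMonoidHom =
        (MulAction.stabilizer (absoluteGaloisGroup ℚ) (m₀ • A₀)).subgroupOf V₂ ∧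
      ∀ (a : absoluteGaloisGroup ℚ) (_ : a ∈ ΓK N) (m : absoluteGaloisGroup ℚ),
        (∀ (g : absoluteGaloisGroup ℚ) (hg : g ∈ ΓK N),
          g ∈ MulAction.stabilizer (absoluteGaloisGroup ℚ) (a • A₀) ↔
            ((β ⟨g, hNV hg⟩ : V₂) : absoluteGaloisGroup ℚ) ∈
              MulAction.stabilizer (absoluteGaloisGroup ℚ) (m • a • A₀)) →
        m⁻¹ * m₁ ∈ ΓK M := by
  classical
  haveI := hMfin
  haveI := hMgal
  have hMN : ΓK M ≤ ΓK N := ΓK_antitone hNM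
  have hMV : ΓK M ≤ V₁ := hMN.trans hNV
  -- invariance of the Galois levels `Γ_L`, `L ⊇ M` finite Galois, and the restriction `β_M`
  have hinvM := map_ΓK_subgroupOf_eq_of_containment hV₁ hV₂ β hβ hβ' M hMV
  have hinv : ∀ L : IntermediateField ℚ (AlgebraicClosure ℚ), FiniteDimensional ℚ L → IsGalois ℚ L →
      ΓK L ≤ ΓK M →
        ((ΓK L).subgroupOf V₁).map β.toMulEquiv.toMonoidHom = (ΓK L).subgroupOf V₂ := by
    intro L hLfin hLgal hLM
    haveI := hLfin
    haveI := hLgal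
    exact (map_ΓK_subgroupOf_eq_of_containment hV₁ hV₂ β hβ hβ' L (hLM.trans hMV)).1
  obtain ⟨βM, hβMv⟩ := exists_mulEquiv_restrict β.toMulEquiv (ΓK M) hMV hinvM.2 hinvM.1
  -- two distinct odd rational primes splitting completely in `M`, primes of `ℚ̄` over them
  obtain ⟨v₀, v₁, hne, h2₀, h2₁, hs₀, hs₁⟩ := exists_two_odd_splitPrimes M
  obtain ⟨A₀, hA₀, hv₀A⟩ := exists_over M v₀
  obtain ⟨A₁, hA₁, hv₁A⟩ := exists_over M v₁
  -- their `β`-correspondents lie over the same places: `m₀ • A₀`, `m₁ • A₁`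
  obtain ⟨B₀, ⟨hB₀, hAB₀⟩, -⟩ :=
    existsUnique_map_stabilizer_subgroupOf_eq_of_isOpen hV₁ hV₂ β hβ hβ' A₀ hA₀
  obtain ⟨B₁, ⟨hB₁, hAB₁⟩, -⟩ :=
    existsUnique_map_stabilizer_subgroupOf_eq_of_isOpen hV₁ hV₂ β hβ hβ' A₁ hA₁
  obtain ⟨m₀, hm₀⟩ := exists_smul_eq_of_over hB₀ hv₀A
    (over_of_map_stabilizer_eq hV₁ hV₂ β hA₀ hB₀ hAB₀ v₀ hv₀A)
  obtain ⟨m₁, hm₁⟩ := exists_smul_eq_of_over hB₁ hv₁A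
    (over_of_map_stabilizer_eq hV₁ hV₂ β hA₁ hB₁ hAB₁ v₁ hv₁A)
  subst hm₀
  subst hm₁
  refine ⟨A₀, m₀, m₁, hAB₀, fun a _ m hiff => ?_⟩
  -- the two correspondences at level `Γ_M`
  have hπ' : ((MulAction.stabilizer (absoluteGaloisGroup ℚ) A₁).subgroupOf (ΓK M)).map βM.toMonoidHom =
      (MulAction.stabilizer (absoluteGaloisGroup ℚ) (m₁ • A₁)).subgroupOf (ΓK M) :=
    map_stabilizer_subgroupOf_restrict β.toMulEquiv hMV hinvM.1 βM hβMv hAB₁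
  have hπ : ((MulAction.stabilizer (absoluteGaloisGroup ℚ) (a • A₀)).subgroupOf (ΓK M)).map
      βM.toMonoidHom =
      (MulAction.stabilizer (absoluteGaloisGroup ℚ) (m • a • A₀)).subgroupOf (ΓK M) :=
    map_subgroupOf_eq_of_forall_iff β.toMulEquiv hMV βM hβMv fun g hg => hiff g (hMN hg)
  exact pair_separation M β hMgal hMV βM hβMv hinv hne h2₀ h2₁ hs₀ hs₁
    (NumberFieldValuationProSet.smul_ne_top ℚ hA₀ a) hA₁ (below_base_smul hv₀A a) hv₁A hπ hπ'

end NeukirchUchidaProof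

end Literature.AnabelianGeometry.AbsoluteAnabelian

end
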